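import Literature.IUT.HodgeTheaters.GlobalFrobenioidsCyclotomes
import Literature.AnabelianGeometry.EtaleTheta.Cyclotome
import HarnessLib

/-!
# [IUTchI] Example 5.1 (v), p. 127–128: the elementary engine behind "there exists a UNIQUE isomorphism
# of cyclotomes … — `ℚ_{>0} ∩ Ẑ^× = {1}`", in the tree's exponent-system language for `Aut(μ_Ẑ) = Ẑ^×`

Mochizuki, *Inter-universal Teichmüller theory I*, §5, Example 5.1 (v), kurims manuscript (May 2020)
p. 127 l. 75 – p. 128 l. 24 ([IUTchI] Ex 5.1 (v) pp.127–128) [claim: Mochizuki2012, status: disputed]: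
"it follows immediately, by considering divisors of zeroes and poles [cf. the definition of a
"`κ`-coric function" given in Remark 3.1.7, (i)] associated to Kummer classes of rational functions as
in [AbsTopIII], Proposition 1.6, (iii), from the elementary observation that, relative to the natural
inclusion `ℚ ↪ Ẑ ⊗ ℚ`, `ℚ_{>0} ∩ Ẑ^× = {1}`, that there exists a unique isomorphism of cyclotomes
`μ^Θ_Ẑ(π₁(†𝒟^⊚)) ⥲ μ_Ẑ(†𝕄^⊛_∞κ)` such that …".

Sub-DAG row E51/L27 (b) of `plan/L5/SUBDAG-IUTchI-Ex51.md` (director-frontier 2026-08-25T23:59:05Z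
queue (1); nodes = IUTchI:Ex5.1(v)).  PROOF-ONLY (theorems, no definitions, no new facts).

**What is proved.**  Two isomorphisms of cyclotomes with the printed property differ by an
automorphism `u ∈ Aut(μ_Ẑ) = Ẑ^×`; in the tree `Ẑ^×` acts on the inverse-limit cyclotome
`Λ(A) = lim A[n]` (`Literature.AnabelianGeometry.EtaleTheta.cyclotome`) through COMPATIBLE UNIT EXPONENT
SYSTEMS `a : ℕ → ℕ` (`a n ≡ a m (mod m)` for `m ∣ n`, `a n` prime to `n`; cf. abc-iut-L6-d1's
`MLFClosure.cyclotome_mulEquiv_exponents`).  "Considering divisors of zeroes and poles" means: the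
Kummer class of a rational function `f` has an INTEGER divisor, and `u · κ(f) = κ(f′)` forces, at a zero
of `f` of order `d > 0`, the congruences `a n · d ≡ d′ (mod n)` for all `n`, where `d′ ∈ ℤ` is the order
of `f′` there.  We prove:
* `exponents_abs_eq` — such congruences force `d′ = d ∨ d′ = −d` ("`u ∈ ℚ ∩ Ẑ^× = {±1}`");
* `exponents_trivial_of_fixes` — if `d′ = d (≠ 0)` then `a n ≡ 1 (mod n)` for all `n` ("`u = 1`");
* `exponents_trivial_of_two_zeros_one_pole` — the printed positivity: if `f` has (at least) TWO distinct
  zeroes (orders `d₁, d₂ > 0`) while `f′` has at most ONE pole (not both `d′₁, d′₂ < 0`) — exactly the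
  shape of `κ`-coric functions, Rmk 3.1.7 (i): "precisely one pole … but at least two distinct zeroes"
  — then `u = 1` ("`ℚ_{>0} ∩ Ẑ^× = {1}`");
* `cyclotome_pow_exponents_eq_self` — an exponent system `≡ 1 (mod n)` acts as the IDENTITY on `Λ(A)`.
The interface step (Kummer classes of rational functions HAVE divisors on which `Ẑ^×` acts by
multiplication — [AbsTopIII] Prop 1.6 (iii)) stays the sub-DAG's residual input; the number theory is
here.  Cf. the tree's valuation form `Literature.IUT.LogThetaLattice.Rat.eq_one_of_forall_padicValRat_eq_zero`
([IUTchIII] Rmk 2.3.3 (vi) cites the same observation).  No side taken on [IUTchIII] Cor. 3.12.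
-/

namespace Literature.IUT.HodgeTheaters

namespace CyclotomeRigidity

/-! ### `ℚ ∩ Ẑ^× = {±1}` in exponent form -/

/-- If a unit exponent system `a` (`a n` prime to `n`) satisfies `a n · d ≡ d′ (mod n)` for all `n ≥ 1`,
with `d ≠ 0`, then `d ∣ d′`. ([IUTchI] Ex 5.1 (v) p.127) [claim: Mochizuki2012, status: disputed] -/
theorem dvd_of_exponents (a : ℕ → ℕ) {d d' : ℤ} (hd : d ≠ 0)
    (h : ∀ n : ℕ, 0 < n → (a n : ℤ) * d ≡ d' [ZMOD n]) : d ∣ d' := by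
  have hn : 0 < d.natAbs := Int.natAbs_pos.mpr hd
  have h1 := (Int.modEq_iff_dvd.mp (h d.natAbs hn))
  -- `|d| ∣ d' - a·d` and `|d| ∣ a·d`, hence `|d| ∣ d'`
  have h2 : (d.natAbs : ℤ) ∣ (a d.natAbs : ℤ) * d :=
    Dvd.dvd.mul_left (Int.natAbs_dvd.mpr (dvd_refl d)) _
  have h3 : (d.natAbs : ℤ) ∣ d' := by
    have := dvd_add h1 h2
    simpa using this
  exact Int.natAbs_dvd.mp h3

/-- … and `d′ ≠ 0` (take `n = 2|d|`: `2 ∣ a n`, contradicting `a n` prime to `n`).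
([IUTchI] Ex 5.1 (v) p.127) [claim: Mochizuki2012, status: disputed] -/
theorem ne_zero_of_exponents (a : ℕ → ℕ) (hcop : ∀ n, 0 < n → (a n).Coprime n) {d d' : ℤ}
    (hd : d ≠ 0) (h : ∀ n : ℕ, 0 < n → (a n : ℤ) * d ≡ d' [ZMOD n]) : d' ≠ 0 := by
  intro hd'
  subst hd'
  have hDpos : 0 < d.natAbs := Int.natAbs_pos.mpr hd
  have hn : 0 < 2 * d.natAbs := by omega
  have h1 : ((2 * d.natAbs : ℕ) : ℤ) ∣ (a (2 * d.natAbs) : ℤ) * d := by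
    have := Int.modEq_iff_dvd.mp (h (2 * d.natAbs) hn)
    rwa [zero_sub, dvd_neg] at this
  -- pass to natural numbers: `2 D ∣ a · D`, so `2 ∣ a`
  have h2 : 2 * d.natAbs ∣ a (2 * d.natAbs) * d.natAbs := by
    have := Int.natAbs_dvd_natAbs.mpr h1
    simp only [Int.natAbs_mul, Int.natAbs_natCast] at this
    exact this
  have h3 : 2 ∣ a (2 * d.natAbs) := Nat.dvd_of_mul_dvd_mul_right hDpos h2
  have h4 : (a (2 * d.natAbs)).Coprime 2 :=
    Nat.Coprime.coprime_dvd_right (Dvd.intro d.natAbs rfl) (hcop (2 * d.natAbs) hn)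
  have h5 : Nat.Coprime 2 2 := Nat.Coprime.coprime_dvd_left h3 h4
  simp at h5

/-- **`ℚ ∩ Ẑ^× = {±1}`, exponent form.**  If a unit exponent system `a` satisfies
`a n · d ≡ d′ (mod n)` for all `n ≥ 1`, with `d ≠ 0`, then `d′ = d` or `d′ = −d`.
([IUTchI] Ex 5.1 (v) p.127) [claim: Mochizuki2012, status: disputed] -/
theorem exponents_abs_eq (a : ℕ → ℕ) (hcop : ∀ n, 0 < n → (a n).Coprime n) {d d' : ℤ}
    (hd : d ≠ 0) (h : ∀ n : ℕ, 0 < n → (a n : ℤ) * d ≡ d' [ZMOD n]) : d' = d ∨ d' = -d := by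
  have hd' : d' ≠ 0 := ne_zero_of_exponents a hcop hd h
  have hdd' : d ∣ d' := dvd_of_exponents a hd h
  -- `d' ∣ d`: at `n = |d|·|d'|`, `d' ∣ a·d` with `a` prime to `d'`
  set D := d.natAbs with hD
  set D' := d'.natAbs with hD'
  have hDpos : 0 < D := Int.natAbs_pos.mpr hd
  have hD'pos : 0 < D' := Int.natAbs_pos.mpr hd'
  have hn : 0 < D * D' := Nat.mul_pos hDpos hD'pos
  have h1 : ((D * D' : ℕ) : ℤ) ∣ d' - (a (D * D') : ℤ) * d := Int.modEq_iff_dvd.mp (h (D * D') hn)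
  have h2 : (D' : ℤ) ∣ (a (D * D') : ℤ) * d := by
    have hD'n : (D' : ℤ) ∣ ((D * D' : ℕ) : ℤ) := ⟨D, by push_cast; ring⟩
    have hD'd' : (D' : ℤ) ∣ d' := Int.natAbs_dvd.mpr (dvd_refl d')
    have := dvd_sub hD'd' (dvd_trans hD'n h1)
    simpa using this
  have h3 : D' ∣ a (D * D') * D := by
    have := Int.natAbs_dvd_natAbs.mpr h2
    simpa [Int.natAbs_mul, Int.natAbs_natCast, hD] using this
  have h4 : (D').Coprime (a (D * D')) :=
    (Nat.Coprime.coprime_dvd_right (Dvd.intro_left D rfl) (hcop (D * D') hn)).symm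
  have h5 : D' ∣ D := h4.dvd_of_dvd_mul_left h3
  have h6 : D ∣ D' := Int.natAbs_dvd_natAbs.mpr hdd'
  have h7 : D = D' := Nat.dvd_antisymm h6 h5
  have h8 : d' = d ∨ d' = -d := by
    have := Int.natAbs_eq_natAbs_iff.mp h7.symm
    exact this
  exact h8

/-! ### `u · d = d` forces `u = 1` -/

/-- **`u = 1` from one fixed integer.**  If a COMPATIBLE unit exponent system `a` satisfies
`a n · d ≡ d (mod n)` for all `n ≥ 1` with `d ≠ 0`, then `a n ≡ 1 (mod n)` for all `n ≥ 1` (apply the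
hypothesis at `n·|d|` and cancel `|d|`; compatibility descends from `n·|d|` to `n`).
([IUTchI] Ex 5.1 (v) p.127) [claim: Mochizuki2012, status: disputed] -/
theorem exponents_trivial_of_fixes (a : ℕ → ℕ)
    (ha : ∀ m n : ℕ, 0 < m → 0 < n → m ∣ n → a n ≡ a m [MOD m]) {d : ℤ} (hd : d ≠ 0)
    (h : ∀ n : ℕ, 0 < n → (a n : ℤ) * d ≡ d [ZMOD n]) : ∀ n : ℕ, 0 < n → a n ≡ 1 [MOD n] := by
  intro n hn
  have hDpos : 0 < d.natAbs := Int.natAbs_pos.mpr hd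
  have hN : 0 < n * d.natAbs := Nat.mul_pos hn hDpos
  -- `n·D ∣ d - a(nD)·d = (1 - a) · d`
  have h1 : ((n * d.natAbs : ℕ) : ℤ) ∣ d - (a (n * d.natAbs) : ℤ) * d :=
    Int.modEq_iff_dvd.mp (h (n * d.natAbs) hN)
  have h2 : n * d.natAbs ∣ (1 - (a (n * d.natAbs) : ℤ)).natAbs * d.natAbs := by
    have := Int.natAbs_dvd_natAbs.mpr h1
    have e : d - (a (n * d.natAbs) : ℤ) * d = (1 - (a (n * d.natAbs) : ℤ)) * d := by ring
    rw [e, Int.natAbs_mul, Int.natAbs_natCast] at this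
    exact this
  have h3 : n ∣ (1 - (a (n * d.natAbs) : ℤ)).natAbs := Nat.dvd_of_mul_dvd_mul_right hDpos h2
  have h4 : (n : ℤ) ∣ 1 - (a (n * d.natAbs) : ℤ) := by
    have := Int.natAbs_dvd_natAbs.mp ((Int.natAbs_natCast n).symm ▸ h3)
    exact this
  have h5 : (a (n * d.natAbs) : ℤ) ≡ ((1 : ℕ) : ℤ) [ZMOD (n : ℕ)] := by
    rw [Int.modEq_iff_dvd]
    simpa using h4
  have h6 : a (n * d.natAbs) ≡ 1 [MOD n] := Int.natCast_modEq_iff.mp h5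
  exact (ha n (n * d.natAbs) hn hN (Dvd.intro d.natAbs rfl)).symm.trans h6

/-! ### The printed positivity: two zeroes of `f`, at most one pole of `f′` -/

/-- **`ℚ_{>0} ∩ Ẑ^× = {1}` as used on p. 127**: let `a` be a compatible unit exponent system [the
automorphism `u` of the cyclotome], `d₁, d₂ > 0` the orders of `f` at two distinct zeroes (Rmk 3.1.7 (i):
a `κ`-coric function has "at least two distinct zeroes") and `d′₁, d′₂ ∈ ℤ` the orders of `f′` at the
same two points, NOT BOTH negative (Rmk 3.1.7 (i): `f′` has "precisely one pole"), with
`a n · dᵢ ≡ d′ᵢ (mod n)` for all `n ≥ 1`, `i = 1, 2` [divisors of the Kummer classes `u·κ(f) = κ(f′)`].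
Then `u = 1`: `a n ≡ 1 (mod n)` for all `n ≥ 1`.  PROVED. ([IUTchI] Ex 5.1 (v) p.127)
[claim: Mochizuki2012, status: disputed] -/
theorem exponents_trivial_of_two_zeros_one_pole (a : ℕ → ℕ)
    (ha : ∀ m n : ℕ, 0 < m → 0 < n → m ∣ n → a n ≡ a m [MOD m])
    (hcop : ∀ n, 0 < n → (a n).Coprime n) {d₁ d₂ d₁' d₂' : ℤ} (hd₁ : 0 < d₁) (hd₂ : 0 < d₂)
    (hpole : ¬ (d₁' < 0 ∧ d₂' < 0))
    (h₁ : ∀ n : ℕ, 0 < n → (a n : ℤ) * d₁ ≡ d₁' [ZMOD n])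
    (h₂ : ∀ n : ℕ, 0 < n → (a n : ℤ) * d₂ ≡ d₂' [ZMOD n]) :
    ∀ n : ℕ, 0 < n → a n ≡ 1 [MOD n] := by
  rcases exponents_abs_eq a hcop hd₁.ne' h₁ with e₁ | e₁
  · subst e₁
    exact exponents_trivial_of_fixes a ha hd₁.ne' h₁
  · rcases exponents_abs_eq a hcop hd₂.ne' h₂ with e₂ | e₂
    · subst e₂
      exact exponents_trivial_of_fixes a ha hd₂.ne' h₂
    · exact absurd ⟨by omega, by omega⟩ hpole

/-! ### An exponent system `≡ 1` acts trivially on the cyclotome -/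

/-- On the tree's inverse-limit cyclotome `Λ(A) = lim A[n]`, raising each component to a power
`a n ≡ 1 (mod n)` is the identity (each `ζ n` is `n`-torsion) — so the automorphism `u` above IS the
identity of `μ_Ẑ`. ([IUTchI] Ex 5.1 (v) p.128) [claim: Mochizuki2012, status: disputed] -/
theorem cyclotome_pow_exponents_eq_self {A : Type*} [CommGroup A] (a : ℕ → ℕ)
    (h1 : ∀ n : ℕ, 0 < n → a n ≡ 1 [MOD n])
    (ζ : Literature.AnabelianGeometry.EtaleTheta.cyclotome A) (n : ℕ+) :
    (ζ : ℕ+ → A) n ^ a n = (ζ : ℕ+ → A) n := by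
  have htor : (ζ : ℕ+ → A) n ^ (n : ℕ) = 1 :=
    Literature.AnabelianGeometry.EtaleTheta.cyclotome.pow_eq_one ζ n
  have hmod : a n % n = 1 % n := h1 n n.pos
  conv_lhs => rw [← Nat.div_add_mod (a n) n, pow_add, pow_mul, htor, one_pow, one_mul, hmod]
  rcases Nat.lt_or_ge 1 (n : ℕ) with hn | hn
  · rw [Nat.mod_eq_of_lt hn, pow_one]
  · have hn1 : (n : ℕ) = 1 := le_antisymm hn (Nat.succ_le_of_lt n.pos)
    have hζ : (ζ : ℕ+ → A) n = 1 := by simpa [hn1] using htor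
    simp [hζ]

/-- Hence: two automorphisms-by-exponents of `Λ(A)` whose exponent systems agree modulo every `n`
coincide on `Λ(A)` — uniqueness of the cyclotome isomorphism once its exponent class is pinned.
([IUTchI] Ex 5.1 (v) p.128) [claim: Mochizuki2012, status: disputed] -/
theorem cyclotome_pow_exponents_congr {A : Type*} [CommGroup A] (a b : ℕ → ℕ)
    (hab : ∀ n : ℕ, 0 < n → a n ≡ b n [MOD n])
    (ζ : Literature.AnabelianGeometry.EtaleTheta.cyclotome A) (n : ℕ+) :
    (ζ : ℕ+ → A) n ^ a n = (ζ : ℕ+ → A) n ^ b n := by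
  have htor : (ζ : ℕ+ → A) n ^ (n : ℕ) = 1 :=
    Literature.AnabelianGeometry.EtaleTheta.cyclotome.pow_eq_one ζ n
  have hmod : a n % n = b n % n := hab n n.pos
  conv_lhs => rw [← Nat.div_add_mod (a n) n, pow_add, pow_mul, htor, one_pow, one_mul, hmod]
  conv_rhs => rw [← Nat.div_add_mod (b n) n, pow_add, pow_mul, htor, one_pow, one_mul]

end CyclotomeRigidity

end Literature.IUT.HodgeTheaters
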